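import Summits.Langlands.Langlands.Theorems.PicardMuOrdinaryMuOrdinaryFamilyRTMod3nDefs
import Summits.Langlands.Langlands.Theorems.PicardMuOrdinaryMuOrdinaryFamilyRTPointFrob
import Summits.Langlands.Langlands.Theorems.PicardMuOrdinaryMuOrdinaryFamilyRTEndgame
import Summits.Langlands.Langlands.Theorems.MuOrdinaryFamilyRT.Negative.AccumulateRegularity
import Literature.NumberTheory.GaloisRepresentations.FrobeniusDensity
import Literature.NumberTheory.Automorphic.ChebotarevArtinRepHolds
import Literature.NumberTheory.GaloisRepresentations.GaloisRepOfLadicLimit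
import Literature.NumberTheory.GaloisRepresentations.CyclotomicCharacterFrobeniusProofs

/-!
# Crux `MuOrdinaryFamilyRT` (stmt-Langlands-13757), line `mod3n-successive-approximation`:
# stub K3 `stub_liePlaces` — Lie-killing places from ONE exact Steinberg element (Chebotarev transport)

`theorem stub_liePlaces : S.stub_liePlaces` for the registered skeleton
`Cruxes/MuOrdinaryFamilyRT/Lines/mod3n_successive_approximation.lean` (statement and vocabulary `cyc`,
`steinbergPoly`, `LiePlaceAt`, `HasLiePlaces`, `HasExactSteinberg`, `S.stub_liePlaces` from the landed
`Theorems/PicardMuOrdinaryMuOrdinaryFamilyRTMod3nDefs.lean`, p117850), in the skeleton's namespace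
`Summit.Langlands.Langlands.Cruxes.MuOrdinaryFamilyRT.Mod3nSuccessiveApproximation`.

**Statement.**  For a generic quartic `f`, a Picard input `ρ_C` (`PicardInput f ι e S₀ ρ_C`) and ONE
`σ ∈ Γ_K` acting on the four roots of `f` with exactly one fixed point, with `‖ε(σ) - 1‖ = 3⁻¹` and
`det(X - ρ_C(σ)) = (X - a)(X - aν)(X - aν²)`, `ν = ε(σ)⁻¹`, `‖a‖ = 1` (`HasExactSteinberg f ρ_C`): for
every `N` and every finite `T` there is a place `v ∉ T` which is Lie-killing modulo `3^N`
(`LiePlaceAt f ρ_C N v`: `v ∤ 3`, `N v ≡ 4, 7 (mod 9)`, `f mod v` has exactly one root in `k_v`, `ρ_C`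
is unramified at `v`, and `det(X - ρ_C(τ⁻¹))` is coefficientwise within `3^{-N}` of
`(X - a)(X - a·Nv)(X - a·Nv²)` for every arithmetic Frobenius `τ` at every prime above `v`).

**Proof (Chebotarev transport, Khare–Thorne 2016, Lemma 6.8).**  Avoid the finite set
`S₀ ∪ T ∪ S(f)` (`S(f) = badPrimes f ∋ λ`, finite: `badPrimes_finite`).  The arithmetic Frobenii at primes
above places outside it are dense in `Γ_K` (`absoluteGaloisGroup.frobenius_dense`, fed by the PROVED
Chebotarev theorem `chebotarev_artinRep_holds`), so one of them, `τ` at `𝔓 ∣ v`, lies in the open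
neighbourhood `U ∋ σ⁻¹` cut out by: (i) `g σ` fixes every root of `f` (stabilisers of roots are open,
`isOpen_stabilizer_root`); (ii) `‖ε(g) - ε(σ⁻¹)‖ < 3⁻¹` (`ε = cyc` is continuous); (iii) for `i < 4`,
`‖coeff_i det(X - ρ_C(g⁻¹)) - coeff_i (X - a)(X - aε(g))(X - aε(g)²)‖ < 3^{-N}` (continuity of the
coefficients of `g ↦ det(X - ρ_C g)`, `LadicLimit.continuous_coeff_charpoly`, of inversion, of `ε` and of
the explicit coefficients `steinbergPoly_coeff`; at `g = σ⁻¹` the difference vanishes by hypothesis,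
`ε(σ⁻¹) = ε(σ)⁻¹`).  Then: `v ∤ 3` (`3 ∣ 3·disc·lc`); `ε(τ) = N v` in `ℤ₃`
(`GaloisRep.cyclotomicCharacter_apply_of_isArithFrobAt`), and `‖ε(σ)⁻¹ - 1‖ = ‖ε(σ) - 1‖ = 3⁻¹`
(`ε(σ)` is a unit) with (ii) give `‖N v - 1‖₃ = 3⁻¹` (isosceles triangles), i.e. `3 ∥ N v - 1`, i.e.
`N v ≡ 4, 7 (mod 9)` (`Padic.norm_intCast_lt_one_iff`, `Padic.norm_int_le_pow_iff_dvd`); by (i) the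
fixed roots of `τ` are those of `σ`, one, and Dedekind (`card_fixed_eq_card_roots`, the route's
`…PointFrob.lean`) turns this into "`f mod v` has exactly one root"; `ρ_C` is unramified at `v ∉ S₀`
(`PicardInput`); finally every arithmetic Frobenius `τ'` at any `𝔓' ∣ v` has
`det(X - ρ_C(τ'⁻¹)) = det(X - ρ_C(τ⁻¹))` (`𝔓' = g𝔓`, `τ'` and `gτg⁻¹` differ by inertia at `𝔓'`, which
`ρ_C` kills, and the characteristic polynomial is a class function: `charpoly_inv_eq_of_isUnramifiedAt`),
so (iii) with `ε(τ) = N v` is the Steinberg congruence for `i < 4`, while for `i ≥ 4` both coefficients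
vanish (cubics).

Only Mathlib and proved tree declarations are used; no new definitions, no named facts
(`chebotarev_artinRep` enters through its discharge `chebotarev_artinRep_holds`).
-/

-- `Summit.Langlands.Langlands.…` (summit = sub-problem name, D-0017 layout) trips `dupNamespace` on every decl.
set_option linter.dupNamespace false

namespace Summit.Langlands.Langlands.Cruxes.MuOrdinaryFamilyRT.Mod3nSuccessiveApproximation

open scoped NumberField Polynomial Matrix Classical Topology
open Field IsDedekindDomain Polynomial
open Literature.NumberTheory.GaloisRepresentations Literature.NumberTheory.Automorphic
open Summit.Langlands.Langlands.Cruxes.MuOrdinaryFamilyRT.CharZeroDominance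
  (K Generic PicardInput Roots instIsGaloisK)
open Summit.Langlands.Langlands.Cruxes.MuOrdinaryFamilyRT.FreeSeedSmoothRt
  (badPrimes badPrimes_finite three_not_mem_of_not_mem_badPrimes card_fixed_eq_card_roots
    isOpen_stabilizer_root)

noncomputable section

namespace LiePlaces

/-! ### A. The cyclotomic character read in `ℚ̄₃` -/

/-- `ℤ₃ → ℚ̄₃` is continuous (it factors through `ℚ₃`). -/
theorem continuous_algebraMap_padicInt : Continuous (algebraMap ℤ_[3] (PadicAlgCl 3)) := by
  have h : (algebraMap ℤ_[3] (PadicAlgCl 3) : ℤ_[3] → PadicAlgCl 3) =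
      (algebraMap ℚ_[3] (PadicAlgCl 3)) ∘ ((↑) : ℤ_[3] → ℚ_[3]) := by
    funext x
    exact IsScalarTower.algebraMap_apply ℤ_[3] ℚ_[3] (PadicAlgCl 3) x
  rw [h]
  exact (continuous_algebraMap ℚ_[3] (PadicAlgCl 3)).comp
    (continuous_subtype_val : Continuous ((↑) : ℤ_[3] → ℚ_[3]))

/-- `ε = cyc : Γ_K → ℚ̄₃` is continuous. -/
theorem continuous_cyc : Continuous cyc := by
  unfold cyc
  exact continuous_algebraMap_padicInt.comp
    (Units.continuous_val.comp (map_continuous (GaloisRep.cyclotomicCharacter K 3)))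

/-- `ε` takes unit values: `‖ε(σ)‖ = 1` (`ℤ₃ → ℚ̄₃` is norm preserving: the landed
`MuOrdinaryFamilyRT.Negative.norm_algebraMap_padicAlgCl`). -/
theorem norm_cyc (σ : absoluteGaloisGroup K) : ‖cyc σ‖ = 1 := by
  unfold cyc
  rw [Summit.Langlands.Langlands.Theorems.MuOrdinaryFamilyRT.Negative.norm_algebraMap_padicAlgCl]
  exact PadicInt.isUnit_iff.mp (Units.isUnit _)

/-- `ε(σ) ≠ 0`. -/
theorem cyc_ne_zero (σ : absoluteGaloisGroup K) : cyc σ ≠ 0 :=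
  norm_ne_zero_iff.mp (by rw [norm_cyc]; exact one_ne_zero)

/-- `ε(σ⁻¹) = ε(σ)⁻¹`. -/
theorem cyc_inv (σ : absoluteGaloisGroup K) : cyc σ⁻¹ = (cyc σ)⁻¹ := by
  unfold cyc
  rw [map_inv, map_units_inv]

/-- **`ε(Frob_v) = N v`** (Serre; tree `GaloisRep.cyclotomicCharacter_apply_of_isArithFrobAt`), read in `ℚ̄₃`. -/
theorem cyc_eq_residueCard {v : HeightOneSpectrum (𝓞 K)} (hv : ((3 : ℕ) : 𝓞 K) ∉ v.asIdeal)
    {𝔓 : Ideal (absIntegers (𝓞 K) K)} (h𝔓 : 𝔓 ∈ v.primesAbove) {τ : absoluteGaloisGroup K}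
    (hτ : IsArithFrobAt (𝓞 K) τ 𝔓) : cyc τ = (v.residueCard : PadicAlgCl 3) := by
  unfold cyc
  rw [GaloisRep.cyclotomicCharacter_apply_of_isArithFrobAt hv h𝔓 hτ, map_natCast]

/-! ### B. `‖n - 1‖₃ = 3⁻¹ ⟹ n ≡ 4, 7 (mod 9)` -/

/-- For a natural number `n`: `‖n - 1‖ = 3⁻¹` in `ℚ̄₃` means `3 ∥ n - 1`, i.e. `n ≡ 4, 7 (mod 9)`. -/
theorem mod_nine_of_norm_sub_one_eq {n : ℕ} (h : ‖(n : PadicAlgCl 3) - 1‖ = (3 : ℝ)⁻¹) :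
    n % 9 = 4 ∨ n % 9 = 7 := by
  have hq : ‖(((n : ℤ) - 1 : ℤ) : ℚ_[3])‖ = (3 : ℝ)⁻¹ := by
    rw [← norm_algebraMap' (PadicAlgCl 3), map_intCast]
    push_cast
    exact h
  have h3 : (3 : ℤ) ∣ (n : ℤ) - 1 := by
    have := (Padic.norm_intCast_lt_one_iff (p := 3) (k := (n : ℤ) - 1)).mp (by rw [hq]; norm_num)
    exact_mod_cast this
  have h9 : ¬ (9 : ℤ) ∣ (n : ℤ) - 1 := by
    intro hd
    have := (Padic.norm_int_le_pow_iff_dvd (p := 3) ((n : ℤ) - 1) 2).mpr (by exact_mod_cast hd)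
    rw [hq] at this
    norm_num at this
  omega

/-! ### C. The Steinberg cubic: coefficients, their continuity and vanishing -/

/-- The Steinberg cubic expanded: `X³ - a(1+ν+ν²) X² + a²(ν+ν²+ν³) X - a³ν³`. -/
theorem steinbergPoly_eq (a ν : PadicAlgCl 3) : steinbergPoly a ν =
    X ^ 3 - C (a * (1 + ν + ν ^ 2)) * X ^ 2 + C (a ^ 2 * (ν + ν ^ 2 + ν ^ 3)) * X
      - C (a ^ 3 * ν ^ 3) := by
  simp only [steinbergPoly, map_mul, map_add, map_pow, map_one]
  ring

/-- The coefficients of the Steinberg cubic, explicitly. -/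
theorem steinbergPoly_coeff (a ν : PadicAlgCl 3) (i : ℕ) : (steinbergPoly a ν).coeff i =
    if i = 0 then -(a ^ 3 * ν ^ 3) else if i = 1 then a ^ 2 * (ν + ν ^ 2 + ν ^ 3)
      else if i = 2 then -(a * (1 + ν + ν ^ 2)) else if i = 3 then 1 else 0 := by
  rw [steinbergPoly_eq]
  simp only [coeff_sub, coeff_add, coeff_C_mul, coeff_X_pow, coeff_X, coeff_C]
  rcases i with _ | _ | _ | _ | i
  · simp
  · simp
  · simp
  · simp
  · simp only [show i + 1 + 1 + 1 + 1 = i + 4 from rfl]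
    simp

/-- Each coefficient of the Steinberg cubic is a continuous function of `ν`. -/
theorem continuous_coeff_steinbergPoly (a : PadicAlgCl 3) (i : ℕ) :
    Continuous fun ν : PadicAlgCl 3 => (steinbergPoly a ν).coeff i := by
  simp only [steinbergPoly_coeff]
  split_ifs <;> fun_prop

/-- The Steinberg cubic has no coefficients beyond degree `3`. -/
theorem steinbergPoly_coeff_eq_zero (a ν : PadicAlgCl 3) {i : ℕ} (hi : 3 < i) :
    (steinbergPoly a ν).coeff i = 0 := by
  rw [steinbergPoly_coeff, if_neg (by omega), if_neg (by omega), if_neg (by omega), if_neg (by omega)]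

/-! ### D. Frobenius bookkeeping: fixed roots, and the characteristic polynomial of `Frob⁻¹` -/

/-- `#Fix(σ | roots of f)` as a filtered cardinality. -/
theorem natCard_fixedBy_eq (f : ℤ[X]) (σ : absoluteGaloisGroup K) :
    Nat.card (MulAction.fixedBy (Roots f) σ) =
      (Finset.univ.filter fun α : Roots f => σ • α = α).card := by
  rw [Nat.card_coe_set_eq, ← Set.ncard_coe_finset]
  congr 1
  ext α
  simp [MulAction.mem_fixedBy]

/-- **At an unramified place the GEOMETRIC Frobenii `τ⁻¹` all have the same characteristic polynomial
under `ρ`**: for arithmetic Frobenii `τ` at `𝔓 ∣ v` and `τ'` at `𝔓' = g • 𝔓 ∣ v`, `τ'` and `g τ g⁻¹`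
differ by an element of the inertia group at `𝔓'` (Mathlib `IsArithFrobAt.mul_inv_mem_inertia`,
`IsArithFrobAt.conj`), killed by `ρ`, so `ρ(τ'⁻¹) = ρ(g) ρ(τ⁻¹) ρ(g)⁻¹` and `charpoly` is a class function. -/
theorem charpoly_inv_eq_of_isUnramifiedAt {A : Type*} [CommRing A] [TopologicalSpace A] {n : ℕ}
    {v : HeightOneSpectrum (𝓞 K)} {ρ : FramedGaloisRep K A n} (h : ρ.IsUnramifiedAt v)
    {𝔓 𝔓' : Ideal (absIntegers (𝓞 K) K)} (h𝔓 : 𝔓 ∈ v.primesAbove) (h𝔓' : 𝔓' ∈ v.primesAbove)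
    {τ τ' : absoluteGaloisGroup K} (hτ : IsArithFrobAt (𝓞 K) τ 𝔓) (hτ' : IsArithFrobAt (𝓞 K) τ' 𝔓') :
    FramedRep.charpoly ρ τ'⁻¹ = FramedRep.charpoly ρ τ⁻¹ := by
  obtain ⟨g, rfl⟩ := HeightOneSpectrum.exists_smul_eq_of_mem_primesAbove_holds h𝔓 h𝔓'
  have h1 : ρ τ' = ρ (g * τ * g⁻¹) := by
    have h2 := h _ h𝔓' _ (hτ'.mul_inv_mem_inertia (hτ.conj g))
    rwa [map_mul, map_inv, mul_inv_eq_one] at h2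
  have h3 : ρ τ'⁻¹ = ρ g * (ρ τ⁻¹ * (ρ g)⁻¹) := by
    rw [map_inv, h1, map_mul, map_mul, map_inv, mul_inv_rev, mul_inv_rev, inv_inv, map_inv]
  unfold FramedRep.charpoly
  rw [h3, Units.val_mul, Matrix.charpoly_mul_comm, Units.val_mul, mul_assoc, ← Units.val_mul,
    inv_mul_cancel, Units.val_one, mul_one]

end LiePlaces

/-! ### E. The stub -/

open LiePlaces

/-- **K3 — `stub_liePlaces`**: one exactly Steinberg-shaped 3-cycle element in the image of the Picard
representation gives Lie-killing places modulo `3^N` for every `N`, outside any finite set (Chebotarev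
transport; see the module docstring for the proof).  [KhareThorne2016 Lemma 6.8; Chebotarev] -/
theorem stub_liePlaces : S.stub_liePlaces := by
  intro f ι e S₀ ρC hgen hin hSt N T
  obtain ⟨σ, a, hfix, ha, hcycσ, hcharσ⟩ := hSt
  -- the finite set of places to avoid, and the dense set of Frobenii outside it
  set Sbad : Set (HeightOneSpectrum (𝓞 K)) := (↑S₀ ∪ ↑T) ∪ badPrimes f with hSbad
  have hSfin : Sbad.Finite := (S₀.finite_toSet.union T.finite_toSet).union (badPrimes_finite hgen)
  have hD := absoluteGaloisGroup.frobenius_dense chebotarev_artinRep_holds K Sbad hSfin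
  -- the test functions `F i g = coeff_i charpoly ρ(g⁻¹) - coeff_i steinbergPoly a ε(g)` and the open set `U`
  set F : ℕ → absoluteGaloisGroup K → PadicAlgCl 3 := fun i g =>
    (FramedRep.charpoly ρC g⁻¹).coeff i - (steinbergPoly a (cyc g)).coeff i with hF
  have hFc : ∀ i, Continuous (F i) := fun i =>
    ((LadicLimit.continuous_coeff_charpoly ρC i).comp continuous_inv).sub
      ((continuous_coeff_steinbergPoly a i).comp continuous_cyc)
  set U : Set (absoluteGaloisGroup K) :=
    ((⋂ α : Roots f, (fun g => g * σ) ⁻¹'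
        ((MulAction.stabilizer (absoluteGaloisGroup K) α : Subgroup (absoluteGaloisGroup K)) :
          Set (absoluteGaloisGroup K))) ∩
      cyc ⁻¹' Metric.ball (cyc σ⁻¹) 3⁻¹) ∩
    ⋂ i ∈ Finset.range 4, F i ⁻¹' Metric.ball 0 ((3 : ℝ)⁻¹ ^ N) with hU
  have hUo : IsOpen U := by
    refine ((isOpen_iInter_of_finite fun α => ?_).inter ?_).inter ?_
    · exact (isOpen_stabilizer_root f α).preimage (continuous_mul_const σ)
    · exact Metric.isOpen_ball.preimage continuous_cyc
    · exact isOpen_biInter_finset fun i _ => Metric.isOpen_ball.preimage (hFc i)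
  have hσU : σ⁻¹ ∈ U := by
    refine ⟨⟨Set.mem_iInter.2 fun α => ?_, ?_⟩, Set.mem_iInter₂.2 fun i _ => ?_⟩
    · rw [Set.mem_preimage, SetLike.mem_coe, MulAction.mem_stabilizer_iff, inv_mul_cancel, one_smul]
    · rw [Set.mem_preimage, Metric.mem_ball, dist_self]
      norm_num
    · rw [Set.mem_preimage, Metric.mem_ball, dist_zero_right, hF]
      simp only [inv_inv, hcharσ, cyc_inv, sub_self, norm_zero]
      positivity
  -- a Frobenius `τ` at `𝔓 ∣ v`, `v ∉ Sbad`, inside `U`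
  obtain ⟨τ, ⟨v, hvS, 𝔓, h𝔓, hτ⟩, hτU⟩ := hD.exists_mem_open hUo ⟨σ⁻¹, hσU⟩
  obtain ⟨⟨hτ1, hτ2⟩, hτ3⟩ := hτU
  rw [Set.mem_iInter] at hτ1
  rw [Set.mem_iInter₂] at hτ3
  rw [Set.mem_preimage, Metric.mem_ball, dist_eq_norm] at hτ2
  have hvS₀ : v ∉ S₀ := fun h' => hvS (Or.inl (Or.inl h'))
  have hvT : v ∉ T := fun h' => hvS (Or.inl (Or.inr h'))
  have hvbad : v ∉ badPrimes f := fun h' => hvS (Or.inr h')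
  have h3 : ((3 : ℕ) : 𝓞 K) ∉ v.asIdeal := by
    rw [Nat.cast_ofNat]
    exact three_not_mem_of_not_mem_badPrimes hvbad
  have hunr : ρC.IsUnramifiedAt v := (hin.2.2 v hvS₀).1
  have hcycτ : cyc τ = (v.residueCard : PadicAlgCl 3) := cyc_eq_residueCard h3 h𝔓 hτ
  -- `‖N v - 1‖ = 3⁻¹`
  have hN1 : ‖(v.residueCard : PadicAlgCl 3) - 1‖ = (3 : ℝ)⁻¹ := by
    have hσ1 : ‖cyc σ⁻¹ - 1‖ = (3 : ℝ)⁻¹ := by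
      rw [cyc_inv, show (cyc σ)⁻¹ - 1 = (cyc σ)⁻¹ * (1 - cyc σ) by
        rw [mul_sub, mul_one, inv_mul_cancel₀ (cyc_ne_zero σ)], norm_mul, norm_inv, norm_cyc,
        inv_one, one_mul, norm_sub_rev, hcycσ]
    have hne : ‖cyc τ - cyc σ⁻¹‖ ≠ ‖cyc σ⁻¹ - 1‖ := by
      rw [hσ1]
      exact hτ2.ne
    rw [← hcycτ, show cyc τ - 1 = (cyc τ - cyc σ⁻¹) + (cyc σ⁻¹ - 1) by ring,
      IsUltrametricDist.norm_add_eq_max_of_norm_ne_norm hne, hσ1, max_eq_right hτ2.le]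
  refine ⟨v, hvT, h3, mod_nine_of_norm_sub_one_eq hN1, ?_, hunr, a, ha, ?_⟩
  · -- `f mod v` has exactly one root: Dedekind, and `Fix(τ) = Fix(σ)` on the roots
    rw [← card_fixed_eq_card_roots hgen hvbad h𝔓 hτ]
    have hτα : ∀ α : Roots f, τ • α = α ↔ σ • α = α := fun α => by
      have h1 : (τ * σ) • (σ⁻¹ • α) = σ⁻¹ • α := by
        have := hτ1 (σ⁻¹ • α)
        rwa [Set.mem_preimage, SetLike.mem_coe, MulAction.mem_stabilizer_iff] at this
      rw [mul_smul, smul_inv_smul] at h1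
      rw [h1, inv_smul_eq_iff, eq_comm]
    rw [Finset.filter_congr fun α _ => hτα α, ← natCard_fixedBy_eq, hfix]
  · -- the Steinberg congruence for every arithmetic Frobenius at every prime above `v`
    intro 𝔓' h𝔓' τ' hτ' i
    rw [charpoly_inv_eq_of_isUnramifiedAt hunr h𝔓 h𝔓' hτ hτ']
    by_cases hi : i < 4
    · have := hτ3 i (Finset.mem_range.2 hi)
      rw [Set.mem_preimage, Metric.mem_ball, dist_zero_right, hF] at this
      simp only [hcycτ] at this
      exact this.le
    · have hc : (FramedRep.charpoly ρC τ⁻¹).coeff i = 0 :=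
        coeff_eq_zero_of_natDegree_lt (by rw [LadicLimit.natDegree_charpoly]; omega)
      rw [hc, steinbergPoly_coeff_eq_zero a _ (by omega), sub_zero, norm_zero]
      positivity

end

end Summit.Langlands.Langlands.Cruxes.MuOrdinaryFamilyRT.Mod3nSuccessiveApproximation
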